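import Literature.Geometry.Symplectic.GromovR4StdModel
import Literature.Geometry.Kaehler.PoincareLemmaFlat
import Literature.Analysis.ODE.CompactSupportFlow
import Mathlib.Analysis.Calculus.FDeriv.ContinuousAlternatingMap
import Mathlib.Analysis.Calculus.FDeriv.Symmetric
import HarnessLib

/-!
# Moser's argument on a vector space: calculus lemmas (helper for stub `stub_tameMoser`)

Third helper file for stub `stub_tameMoser` of line `cross-cap-laurent` (crux
`GromovRecognitionRelEnd`, item stmt-SmoothPoincare4-11009). Finite-dimensional calculus behind
Moser's isotopy argument (McDuff–Salamon (2017), §3.2; Lee (2013), Prop. 22.15) for Mathlib forms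
`E → E [⋀^Fin k]→L[ℝ] F` on a real normed space, its `extDeriv` and `fderiv`:

* `hasDerivAt_twoForm_apply` — Leibniz rule for `t ↦ A(t)(a(t), b(t))`;
* `moser_pointwise` — **the pointwise Moser/Cartan cancellation**: if `dΩ = 0` (alternatisation of
  `DΩ` vanishes), `Alt(DB) = Ω̇` and `ι_X Ω = −B` holds to first order
  (`ι_X (DΩ a) + ι_{DX a} Ω = −DB a`), then `Ω̇(a,b) + (DΩ X)(a,b) + Ω(DX a, b) + Ω(a, DX b) = 0`
  — the coordinate form of `L_X Ω + Ω̇ = d ι_X Ω + ι_X dΩ + Ω̇ = −dB + 0 + Ω̇ = 0`;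
* `isInvertible_curryLeft_of_nondegenerate` — for a nondegenerate `2`-form `Ω` on a
  finite-dimensional space, `v ↦ ι_v Ω` is invertible (so the Moser field `ι_V Ω = −B` exists);
* `contDiff_inverse_family` — the inverse of a `C^∞` family of invertible maps is `C^∞`;
* `hasDerivAt_fderiv_flow` — **the variational equation**: for a `C^∞` map `Θ(t, y)` with
  `∂ₜ Θ(t, y) = V(t, Θ(t, y))`, `∂ₜ D_yΘ(t, y) v = D_y V(t, Θ(t,y)) (D_yΘ(t, y) v)` (symmetry of
  second derivatives).

Everything is proved; no definition, no named fact.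

References: D. McDuff, D. Salamon, *Introduction to Symplectic Topology*, 3rd ed. (2017), §3.2;
J. M. Lee, *Introduction to Smooth Manifolds*, 2nd ed. (2013), Prop. 22.15, Thm. 22.16.
-/

noncomputable section

-- the prescribed namespace `Summit.<P>.<Sub>.…` duplicates `SmoothPoincare4` (P = Sub)
set_option linter.dupNamespace false

open scoped Manifold ContDiff Topology
open Set TopologicalSpace Literature.Geometry.Kaehler Literature.Geometry.Symplectic

namespace Summit.SmoothPoincare4.SmoothPoincare4.Theorems.GromovRecognitionRelEnd.CrossCapLaurent

variable {E : Type*} [NormedAddCommGroup E] [NormedSpace ℝ E]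
  {F : Type*} [NormedAddCommGroup F] [NormedSpace ℝ F]

/-! ## Leibniz rule for a `2`-form evaluated on two moving vectors -/

/-- **Leibniz rule** for `t ↦ A(t)(a(t), b(t))`, `A` a curve of continuous alternating `2`-forms
and `a, b` curves of vectors: the derivative is `A'(a, b) + A(a', b) + A(a, b')`. [folklore] -/
theorem hasDerivAt_twoForm_apply {A : ℝ → E [⋀^Fin 2]→L[ℝ] F} {a b : ℝ → E}
    {A' : E [⋀^Fin 2]→L[ℝ] F} {a' b' : E} {s : ℝ} (hA : HasDerivAt A A' s)
    (ha : HasDerivAt a a' s) (hb : HasDerivAt b b' s) :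
    HasDerivAt (fun t ↦ A t ![a t, b t]) (A' ![a s, b s] + A s ![a', b s] + A s ![a s, b']) s := by
  classical
  set g : Fin 2 → ℝ → E := ![a, b] with hg
  set g' : Fin 2 → ℝ →L[ℝ] E :=
    ![(1 : ℝ →L[ℝ] ℝ).smulRight a', (1 : ℝ →L[ℝ] ℝ).smulRight b'] with hg'
  have hgd : ∀ i, HasFDerivAt (g i) (g' i) s := fun i ↦ by
    fin_cases i
    · exact ha.hasFDerivAt
    · exact hb.hasFDerivAt
  have h := (hA.hasFDerivAt.continuousAlternatingMap_apply hgd).hasDerivAt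
  have hfun : (fun t ↦ A t fun i ↦ g i t) = fun t ↦ A t ![a t, b t] := by
    funext t
    congr 1
    funext i
    fin_cases i <;> rfl
  rw [hfun] at h
  convert h using 1
  have hgs : (fun i ↦ g i s) = ![a s, b s] := by funext i; fin_cases i <;> rfl
  simp only [add_apply, ContinuousLinearMap.coe_comp, Function.comp_apply,
    ContinuousLinearMap.toSpanSingleton_apply, one_smul, ContinuousAlternatingMap.apply_apply,
    Fin.sum_univ_two, hgs]
  have h0 : (A s).toContinuousLinearMap ![a s, b s] 0 (g' 0 1) = A s ![a', b s] := by
    rw [ContinuousAlternatingMap.toContinuousLinearMap_apply]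
    congr 1
    funext i
    fin_cases i <;> simp [hg']
  have h1 : (A s).toContinuousLinearMap ![a s, b s] 1 (g' 1 1) = A s ![a s, b'] := by
    rw [ContinuousAlternatingMap.toContinuousLinearMap_apply]
    congr 1
    funext i
    fin_cases i <;> simp [hg']
  rw [h0, h1, add_assoc]


/-! ## The pointwise Moser–Cartan cancellation -/

/-- `removeNth` on a triple, index `0`. [folklore] -/
theorem removeNth_zero_three {α : Type*} (x a b : α) :
    Fin.removeNth (0 : Fin 3) ![x, a, b] = ![a, b] := by
  funext i; fin_cases i <;> rfl

/-- `removeNth` on a triple, index `1`. [folklore] -/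
theorem removeNth_one_three {α : Type*} (x a b : α) :
    Fin.removeNth (1 : Fin 3) ![x, a, b] = ![x, b] := by
  funext i; fin_cases i <;> rfl

/-- `removeNth` on a triple, index `2`. [folklore] -/
theorem removeNth_two_three {α : Type*} (x a b : α) :
    Fin.removeNth (2 : Fin 3) ![x, a, b] = ![x, a] := by
  funext i; fin_cases i <;> rfl

/-- `removeNth` on a pair, index `0`. [folklore] -/
theorem removeNth_zero_two {α : Type*} (a b : α) : Fin.removeNth (0 : Fin 2) ![a, b] = ![b] := by
  funext i; fin_cases i; rfl

/-- `removeNth` on a pair, index `1`. [folklore] -/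
theorem removeNth_one_two {α : Type*} (a b : α) : Fin.removeNth (1 : Fin 2) ![a, b] = ![a] := by
  funext i; fin_cases i; rfl

/-- The alternatisation of `f : E →L (2-forms)` on a triple:
`Alt f (x, a, b) = f x (a, b) − f a (x, b) + f b (x, a)` (Mathlib's normalisation of `extDeriv`).
[folklore] -/
theorem alternatizeUncurryFin_apply_three (f : E →L[ℝ] E [⋀^Fin 2]→L[ℝ] F) (x a b : E) :
    ContinuousAlternatingMap.alternatizeUncurryFin f ![x, a, b] =
      f x ![a, b] - f a ![x, b] + f b ![x, a] := by
  rw [ContinuousAlternatingMap.alternatizeUncurryFin_apply, Fin.sum_univ_three]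
  simp only [Fin.val_zero, pow_zero, one_smul, Fin.val_one, pow_one, neg_smul, Fin.val_two,
    Matrix.cons_val_zero, Matrix.cons_val_one, Matrix.cons_val, removeNth_zero_three,
    removeNth_one_three, removeNth_two_three]
  norm_num
  abel

/-- The alternatisation of `f : E →L (1-forms)` on a pair: `Alt f (a, b) = f a (b) − f b (a)`.
[folklore] -/
theorem alternatizeUncurryFin_apply_two (f : E →L[ℝ] E [⋀^Fin 1]→L[ℝ] F) (a b : E) :
    ContinuousAlternatingMap.alternatizeUncurryFin f ![a, b] = f a ![b] - f b ![a] := by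
  rw [ContinuousAlternatingMap.alternatizeUncurryFin_apply, Fin.sum_univ_two]
  simp only [Fin.val_zero, pow_zero, one_smul, Fin.val_one, pow_one, neg_smul,
    Matrix.cons_val_zero, Matrix.cons_val_one, removeNth_zero_two, removeNth_one_two]
  abel

/-- A `2`-form is antisymmetric: `Ω(a, b) = −Ω(b, a)`. [folklore] -/
theorem twoForm_swap' (Ω : E [⋀^Fin 2]→L[ℝ] F) (a b : E) : Ω ![a, b] = -Ω ![b, a] := by
  have h := Ω.map_swap ![b, a] (i := 0) (j := 1) zero_ne_one
  have hs : (![b, a] : Fin 2 → E) ∘ ⇑(Equiv.swap (0 : Fin 2) 1) = ![a, b] := by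
    funext i; fin_cases i <;> rfl
  rw [hs] at h
  exact h

/-- **The pointwise Moser–Cartan cancellation** (McDuff–Salamon (2017), §3.2, proof of
Thm. 3.2.4; Lee (2013), Prop. 22.15 in coordinates). At a point, let `Ω` be a `2`-form with
derivative `DΩ` whose alternatisation vanishes (`dΩ = 0`), `DB` the derivative of a `1`-form with
`Alt DB = Ω̇` (`dB = Ω̇`), and `X` a vector with derivative `DX` such that `ι_X Ω = −B` to first
order, `ι_X (DΩ a) + ι_{DX a} Ω = −DB a`. Then
`Ω̇(a, b) + (DΩ X)(a, b) + Ω(DX a, b) + Ω(a, DX b) = 0`, i.e. `L_X Ω + Ω̇ = 0`.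
[cite: McDuffSalamon2017, §3.2] -/
theorem moser_pointwise {Ω Ω' : E [⋀^Fin 2]→L[ℝ] ℝ} {DΩ : E →L[ℝ] E [⋀^Fin 2]→L[ℝ] ℝ}
    {DB : E →L[ℝ] E [⋀^Fin 1]→L[ℝ] ℝ} {X : E} {DX : E →L[ℝ] E}
    (hcl : ContinuousAlternatingMap.alternatizeUncurryFin DΩ = 0)
    (hB : ContinuousAlternatingMap.alternatizeUncurryFin DB = Ω')
    (hrel : ∀ a, (DΩ a).curryLeft X + Ω.curryLeft (DX a) = -(DB a)) (a b : E) :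
    Ω' ![a, b] + DΩ X ![a, b] + Ω ![DX a, b] + Ω ![a, DX b] = 0 := by
  have r1 := congrArg (fun f : E [⋀^Fin 1]→L[ℝ] ℝ ↦ f ![b]) (hrel a)
  have r2 := congrArg (fun f : E [⋀^Fin 1]→L[ℝ] ℝ ↦ f ![a]) (hrel b)
  have c1 := congrArg (fun f : E [⋀^Fin 3]→L[ℝ] ℝ ↦ f ![X, a, b]) hcl
  have c2 := congrArg (fun f : E [⋀^Fin 2]→L[ℝ] ℝ ↦ f ![a, b]) hB
  simp only [ContinuousAlternatingMap.add_apply, ContinuousAlternatingMap.curryLeft_apply_apply,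
    ContinuousAlternatingMap.neg_apply, ContinuousAlternatingMap.coe_zero, Pi.zero_apply,
    alternatizeUncurryFin_apply_three, alternatizeUncurryFin_apply_two] at r1 r2 c1 c2
  have sw := twoForm_swap' Ω a (DX b)
  linarith


/-! ## The Moser field: invertibility of `v ↦ ι_v Ω` and smoothness of inverses -/

/-- **A nondegenerate `2`-form on a finite-dimensional space has invertible `v ↦ ι_v Ω`**
(injective by nondegeneracy, and `dim E = dim E^* = dim (E [⋀^Fin 1]→L ℝ)`), so that the
Moser field `ι_V Ω = −B` is well defined. McDuff–Salamon (2017), §3.2 (the vector field `X_t`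
of Moser's argument). [cite: McDuffSalamon2017, §3.2] -/
theorem isInvertible_curryLeft_of_nondegenerate [FiniteDimensional ℝ E] (Ω : E [⋀^Fin 2]→L[ℝ] ℝ)
    (h : ∀ v, v ≠ 0 → ∃ w, Ω ![v, w] ≠ 0) :
    (Ω.curryLeft : E →L[ℝ] E [⋀^Fin 1]→L[ℝ] ℝ).IsInvertible := by
  have hinj : Function.Injective (Ω.curryLeft : E →L[ℝ] E [⋀^Fin 1]→L[ℝ] ℝ) := by
    intro v w hvw
    rw [← sub_eq_zero]
    by_contra hne
    obtain ⟨u, hu⟩ := h (v - w) hne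
    apply hu
    have h0 : Ω.curryLeft (v - w) = 0 := by rw [map_sub, hvw, sub_self]
    have h2 := congrArg (fun f : E [⋀^Fin 1]→L[ℝ] ℝ ↦ f ![u]) h0
    simpa only [ContinuousAlternatingMap.curryLeft_apply_apply, ContinuousAlternatingMap.coe_zero,
      Pi.zero_apply] using h2
  have e1 : (E →L[ℝ] ℝ) ≃ₗ[ℝ] (E [⋀^Fin 1]→L[ℝ] ℝ) :=
    (ContinuousAlternatingMap.ofSubsingletonLIE (𝕜 := ℝ) (E := E) (F := ℝ)
      (0 : Fin 1)).toLinearEquiv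
  have e2 : (E →ₗ[ℝ] ℝ) ≃ₗ[ℝ] (E →L[ℝ] ℝ) := LinearMap.toContinuousLinearMap
  haveI hfd1 : FiniteDimensional ℝ (E →L[ℝ] ℝ) := LinearEquiv.finiteDimensional e2
  haveI hfd2 : FiniteDimensional ℝ (E [⋀^Fin 1]→L[ℝ] ℝ) := LinearEquiv.finiteDimensional e1
  have hdim : Module.finrank ℝ E = Module.finrank ℝ (E [⋀^Fin 1]→L[ℝ] ℝ) := by
    rw [← e1.finrank_eq, ← e2.finrank_eq]
    exact (Subspace.dual_finrank_eq (K := ℝ) (V := E)).symm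
  refine ⟨(LinearMap.linearEquivOfInjective
    (Ω.curryLeft : E →L[ℝ] E [⋀^Fin 1]→L[ℝ] ℝ).toLinearMap hinj hdim).toContinuousLinearEquiv, ?_⟩
  ext v u
  rfl

/-- **The inverse of a `C^n` family of invertible continuous linear maps is `C^n`** (inversion is
`C^∞` at invertible maps, Mathlib's `ContinuousLinearMap.IsInvertible.contDiffAt_map_inverse`).
[folklore] -/
theorem contDiff_inverse_family {P : Type*} [NormedAddCommGroup P] [NormedSpace ℝ P]
    {G : Type*} [NormedAddCommGroup G] [NormedSpace ℝ G] [CompleteSpace E]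
    {A : P → E →L[ℝ] G} {n : WithTop ℕ∞} (hA : ContDiff ℝ n A)
    (hinv : ∀ p, (A p).IsInvertible) : ContDiff ℝ n fun p ↦ (A p).inverse :=
  contDiff_iff_contDiffAt.2 fun p ↦ (hinv p).contDiffAt_map_inverse.comp p hA.contDiffAt

/-! ## The variational equation of a flow -/

/-- The curve `t ↦ (t, z)` has velocity `(1, 0)`. [folklore] -/
theorem hasDerivAt_prodMk_const (z : E) (t : ℝ) :
    HasDerivAt (fun s : ℝ ↦ ((s, z) : ℝ × E)) ((1 : ℝ), (0 : E)) t :=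
  (hasDerivAt_id t).prodMk (hasDerivAt_const t z)

/-- **The variational equation** (Lee (2013), proof of Thm. 22.16 / Prop. 9.? ; McDuff–Salamon
(2017), §3.2): if `Θ(t, y)` is `C^∞` jointly and solves `∂ₜ Θ(t, y) = V(t, Θ(t, y))` for a `C^∞`
time-dependent field `V`, then the space derivative `D_yΘ(t, y) v` solves the linearised equation
`∂ₜ (D_yΘ(t, y) v) = D_y V(t, Θ(t, y)) (D_yΘ(t, y) v)` (equality of mixed partials of `Θ`).
[cite: LeeSmoothManifolds2013, Thm. 22.16] -/
theorem hasDerivAt_fderiv_flow {V Θ : ℝ × E → E} (hV : ContDiff ℝ ∞ V) (hΘ : ContDiff ℝ ∞ Θ)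
    (hflow : ∀ t y, HasDerivAt (fun s ↦ Θ (s, y)) (V (t, Θ (t, y))) t) (s : ℝ) (y v : E) :
    HasDerivAt (fun t ↦ fderiv ℝ (fun z ↦ Θ (t, z)) y v)
      (fderiv ℝ (fun z ↦ V (s, z)) (Θ (s, y)) (fderiv ℝ (fun z ↦ Θ (s, z)) y v)) s := by
  have hinf : (∞ : WithTop ℕ∞) ≠ 0 := by simp
  have hmin : minSmoothness ℝ 2 ≤ ∞ := by
    rw [minSmoothness_of_isRCLikeNormedField]
    exact WithTop.coe_le_coe.2 le_top
  set Θ₁ : ℝ × E → (ℝ × E →L[ℝ] E) := fderiv ℝ Θ with hΘ₁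
  have hΘ₁s : ContDiff ℝ ∞ Θ₁ := hΘ.fderiv_right (m := ∞) (by simp)
  -- partial derivatives in `z` through `Θ₁`
  have hpart : ∀ t z, HasFDerivAt (fun z ↦ Θ (t, z))
      ((Θ₁ (t, z)).comp (ContinuousLinearMap.inr ℝ ℝ E)) z :=
    fun t z ↦ Literature.Analysis.FunctionSpaces.hasFDerivAt_comp_prodMk hΘ hinf t z
  have ha : ∀ t, fderiv ℝ (fun z ↦ Θ (t, z)) y v = Θ₁ (t, y) ((0 : ℝ), v) := fun t ↦ by
    rw [(hpart t y).fderiv]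
    rfl
  -- derivative in `t` of `t ↦ Θ₁ (t, y) (0, v)`
  have hii : HasDerivAt (fun t ↦ Θ₁ (t, y) ((0 : ℝ), v))
      (fderiv ℝ Θ₁ (s, y) ((1 : ℝ), (0 : E)) ((0 : ℝ), v)) s := by
    have h1 : HasDerivAt (fun t ↦ Θ₁ (t, y)) (fderiv ℝ Θ₁ (s, y) ((1 : ℝ), (0 : E))) s :=
      ((hΘ₁s.differentiable hinf) (s, y)).hasFDerivAt.comp_hasDerivAt s
        (hasDerivAt_prodMk_const y s)
    have h2 := h1.clm_apply (hasDerivAt_const s (((0 : ℝ), v) : ℝ × E))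
    simpa using h2
  -- symmetry of the second derivative
  have hsymm : fderiv ℝ Θ₁ (s, y) ((1 : ℝ), (0 : E)) ((0 : ℝ), v) =
      fderiv ℝ Θ₁ (s, y) ((0 : ℝ), v) ((1 : ℝ), (0 : E)) :=
    (hΘ.contDiffAt.isSymmSndFDerivAt (n := ∞) hmin) _ _
  -- the mixed partial the other way
  have hiv : fderiv ℝ (fun z ↦ Θ₁ (s, z) ((1 : ℝ), (0 : E))) y v =
      fderiv ℝ Θ₁ (s, y) ((0 : ℝ), v) ((1 : ℝ), (0 : E)) := by
    have h1 : HasFDerivAt (fun z ↦ Θ₁ (s, z))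
        ((fderiv ℝ Θ₁ (s, y)).comp (ContinuousLinearMap.inr ℝ ℝ E)) y :=
      Literature.Analysis.FunctionSpaces.hasFDerivAt_comp_prodMk hΘ₁s hinf s y
    have h2 := h1.clm_apply (hasFDerivAt_const (((1 : ℝ), (0 : E)) : ℝ × E) y)
    rw [h2.fderiv]
    simp
  -- `Θ₁ (s, z) (1, 0) = V (s, Θ (s, z))`: the flow equation
  have hv : (fun z ↦ Θ₁ (s, z) ((1 : ℝ), (0 : E))) = fun z ↦ V (s, Θ (s, z)) := by
    funext z
    have h1 : HasDerivAt (fun t ↦ Θ (t, z)) (Θ₁ (s, z) ((1 : ℝ), (0 : E))) s :=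
      ((hΘ.differentiable hinf) (s, z)).hasFDerivAt.comp_hasDerivAt s (hasDerivAt_prodMk_const z s)
    exact h1.unique (hflow s z)
  -- chain rule
  have hvi : fderiv ℝ (fun z ↦ V (s, Θ (s, z))) y v =
      fderiv ℝ (fun z ↦ V (s, z)) (Θ (s, y)) (fderiv ℝ (fun z ↦ Θ (s, z)) y v) := by
    have hVd : DifferentiableAt ℝ (fun z ↦ V (s, z)) (Θ (s, y)) :=
      (Literature.Analysis.FunctionSpaces.hasFDerivAt_comp_prodMk hV hinf s _).differentiableAt
    have hΘd : DifferentiableAt ℝ (fun z ↦ Θ (s, z)) y := (hpart s y).differentiableAt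
    have hc := fderiv_comp y hVd hΘd
    rw [show ((fun z ↦ V (s, z)) ∘ fun z ↦ Θ (s, z)) = fun z ↦ V (s, Θ (s, z)) from rfl] at hc
    rw [hc]
    rfl
  have hfun : (fun t ↦ fderiv ℝ (fun z ↦ Θ (t, z)) y v) = fun t ↦ Θ₁ (t, y) ((0 : ℝ), v) :=
    funext ha
  rw [hfun]
  refine hii.congr_deriv ?_
  rw [hsymm, ← hiv, hv, hvi]

/-- **Registered helper sub-goal `helper_moserPointwise`** (one-line form of `moser_pointwise`
over `Type`): the pointwise Moser–Cartan cancellation. [cite: McDuffSalamon2017, §3.2] -/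
theorem helper_moserPointwise : ∀ (E : Type) [NormedAddCommGroup E] [NormedSpace ℝ E]
    (Ω Ω' : E [⋀^Fin 2]→L[ℝ] ℝ) (DΩ : E →L[ℝ] E [⋀^Fin 2]→L[ℝ] ℝ)
    (DB : E →L[ℝ] E [⋀^Fin 1]→L[ℝ] ℝ) (X : E) (DX : E →L[ℝ] E),
    ContinuousAlternatingMap.alternatizeUncurryFin DΩ = 0 →
    ContinuousAlternatingMap.alternatizeUncurryFin DB = Ω' →
    (∀ a, (DΩ a).curryLeft X + Ω.curryLeft (DX a) = -(DB a)) →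
    ∀ a b, Ω' ![a, b] + DΩ X ![a, b] + Ω ![DX a, b] + Ω ![a, DX b] = 0 :=
  fun _ _ _ _ _ _ _ _ _ hcl hB hrel a b ↦ moser_pointwise hcl hB hrel a b

end Summit.SmoothPoincare4.SmoothPoincare4.Theorems.GromovRecognitionRelEnd.CrossCapLaurent

end
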